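import Literature.Probability.RandomPlanarGeometry.HexSAWStripSurfaceGrowth
import Mathlib.Analysis.MeanInequalities
import Mathlib.Analysis.Convex.Function
import HarnessLib

/-!
# `ν_T(y)` is a log-convex, continuous function of `log y` (BBdGDCG14, Proposition 6 — last sentence), and the
# strictness it propagates

Topic `Literature/Probability/RandomPlanarGeometry` (continues `HexSAWStripSurfaceGrowth.lean` — `HV.stripChains T n`, the partition
functions `HV.stripZL T n y = Σ_{ω} y^{topCnt ω}` of the `n`-step self-avoiding walks of the Duminil-Copin–Smirnov strip `S_T` with a
fugacity `y` per vertex on the top level, the growth rate `HV.stripNu T y = ν_T(y) = lim Z_n(y)^{1/n}` (`HV.tendsto_stripZL_rpow`),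
`HV.stripNu_pos`, `HV.stripNu_mono_y`, `HV.stripNu_scale_le`).  Source: N. R. Beaton, M. Bousquet-Mélou, J. de Gier, H. Duminil-Copin,
A. J. Guttmann, *The critical fugacity for surface adsorption of self-avoiding walks on the honeycomb lattice is `1 + √2`*, Comm. Math.
Phys. 326 (2014) 727–754, arXiv:1109.0358v5, §3.2 Proposition 6 (p. 10), last sentence: "Finally, `μ_T(1,y)` is a log-convex and thus
continuous function of `log(y)`" (proof p. 11: "The log-convexity result is easily adapted from [16]" = van Rensburg–Orlandini–Whittington
2006), and its use in the proof of Corollary 8 (p. 13, the sentence before display (15)): "The uniqueness of `y_T` follows from the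
log-convexity of `ρ_T(y)` in `log y`, together with `ρ_T(1) > x_c`: this precludes having `ρ_T(y) = ρ_T(y′) = x_c` with `y ≠ y′`"
(`ρ_T(y) := 1/μ_T(1,y)`, p. 12).

## What is proved (namespace `Literature.Probability.RandomPlanarGeometry.SAW.HV`; `T ≥ 1`; standard axioms)

* `stripZL_interp_le` — Hölder: `Z_n(y₁^θ y₂^{1−θ}) ≤ Z_n(y₁)^θ Z_n(y₂)^{1−θ}` (`y₁, y₂ > 0`, `θ ∈ [0,1]`; each `Z_n` is a sum of
  powers `y^{c(ω)}`);
* ★ **`stripNu_interp_le`** — `ν_T(y₁^θ y₂^{1−θ}) ≤ ν_T(y₁)^θ ν_T(y₂)^{1−θ}`, i.e. **`convexOn_log_stripNu_exp`**: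
  `s ↦ log ν_T(e^s)` is convex on `ℝ` (the printed sentence); `continuousOn_stripNu` — `ν_T` is continuous on `(0, ∞)` (from the
  tree's two moduli `ν_T(y) ≤ ν_T(λy) ≤ λ ν_T(y)`);
* the strictness a convex non-decreasing function propagates from ONE strict pair `y₁ < y₂`, `ν_T(y₁) < ν_T(y₂)`:
  **`stripNu_lt_of_lt_right`** (`ν_T(y) < ν_T(y₂)` for every `0 < y < y₂`), **`stripNu_lt_of_right_lt`** (`ν_T(y₂) < ν_T(y)` for every
  `y > y₂`), `strictMonoOn_stripNu_Ici` (`ν_T` is strictly increasing on `[y₂, ∞)`) — the mechanism of Corollary 8's uniqueness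
  clause ("this precludes having `ρ_T(y) = ρ_T(y′) = x_c` with `y ≠ y′`"), applied to the lane's threshold `y_T` downstream.

Label: CONSOLIDATION (printed statement, printed mechanism — log-convexity by Hölder on the finite partition functions, passed to the
limit); the strictness-propagation lemmas are convexity folklore.  Frames: this file is Proposition 6's last sentence in the HV/DCS
frame (the top-weighted rate `HV.stripNu` of `HexSAWStripSurfaceGrowth.lean`, the rate of the lane's `y_T` chain); its PRINTED-frame twin
(for the brick-wall one-level weight `HexBW.stripMuY₀ T y = μ_T(y,1)`) is a-idea-1 g22's «LEVEL-0 PROP6 RIDERS» rider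
(`HexSAWBrickWallStripFugacityLevel0Prop6.lean`, filed by a-p5 g12); the two are joined by the lane's strip dictionary (lead g13 r10).
Lane «pcv-sawmu», a-p2 g12, 2026-08-24 (edition 3: the interpolation helper is `private`; v5 p. 13 wording of the uniqueness sentence).
-/

noncomputable section

open Finset Filter Topology

namespace Literature.Probability.RandomPlanarGeometry.SAW.HV

variable {T : ℕ}

/-! ### Hölder on the finite partition functions -/

/-- `(y₁^θ y₂^{1−θ})^c = (y₁^c)^θ (y₂^c)^{1−θ}` for a natural exponent `c`. [folklore] -/
private theorem pow_interp_eq {y₁ y₂ : ℝ} (hy₁ : 0 ≤ y₁) (hy₂ : 0 ≤ y₂) (θ : ℝ) (c : ℕ) :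
    (y₁ ^ θ * y₂ ^ (1 - θ)) ^ c = (y₁ ^ c) ^ θ * (y₂ ^ c) ^ (1 - θ) := by
  rw [mul_pow, ← Real.rpow_natCast (y₁ ^ θ), ← Real.rpow_natCast (y₂ ^ (1 - θ)), ← Real.rpow_mul hy₁, ← Real.rpow_mul hy₂,
    mul_comm θ, mul_comm (1 - θ), Real.rpow_mul hy₁, Real.rpow_mul hy₂, Real.rpow_natCast, Real.rpow_natCast]

/-- **Hölder: `Z_n(y₁^θ y₂^{1−θ}) ≤ Z_n(y₁)^θ · Z_n(y₂)^{1−θ}`** (`y₁, y₂ > 0`, `0 ≤ θ ≤ 1`) — each partition function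
`Z_n(y) = Σ_ω y^{c(ω)}` is a log-convex function of `log y`.
[cite: BeatonBousquetMelouDeGierDuminilCopinGuttmann2014, Proposition 6 (arXiv v5 p. 10: "μ_T(1,y) is a log-convex … function of log(y)"; proof p. 11)] -/
theorem stripZL_interp_le (T n : ℕ) {y₁ y₂ : ℝ} (hy₁ : 0 < y₁) (hy₂ : 0 < y₂) {θ : ℝ} (hθ₀ : 0 ≤ θ) (hθ₁ : θ ≤ 1) :
    stripZL T n (y₁ ^ θ * y₂ ^ (1 - θ)) ≤ stripZL T n y₁ ^ θ * stripZL T n y₂ ^ (1 - θ) := by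
  rcases hθ₀.eq_or_lt with rfl | hθ₀'
  · simp
  rcases hθ₁.eq_or_lt with rfl | hθ₁'
  · simp
  have hpq : θ⁻¹.HolderConjugate (1 - θ)⁻¹ := Real.HolderConjugate.inv_one_sub_inv hθ₀' hθ₁'
  have h := Real.inner_le_Lp_mul_Lq_of_nonneg (stripChains T n) hpq
    (f := fun l => (y₁ ^ topCnt T l) ^ θ) (g := fun l => (y₂ ^ topCnt T l) ^ (1 - θ))
    (fun l _ => Real.rpow_nonneg (pow_nonneg hy₁.le _) _) (fun l _ => Real.rpow_nonneg (pow_nonneg hy₂.le _) _)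
  have hθne : θ ≠ 0 := hθ₀'.ne'
  have h1θne : 1 - θ ≠ 0 := (sub_pos.2 hθ₁').ne'
  simp only [one_div, inv_inv] at h
  unfold stripZL
  simp_rw [pow_interp_eq hy₁.le hy₂.le θ]
  refine h.trans_eq ?_
  congr 2
  · exact sum_congr rfl fun l _ => Real.rpow_rpow_inv (pow_nonneg hy₁.le _) hθne
  · exact sum_congr rfl fun l _ => Real.rpow_rpow_inv (pow_nonneg hy₂.le _) h1θne

/-! ### Log-convexity and continuity of `ν_T` -/

/-- ★ **`ν_T(y₁^θ y₂^{1−θ}) ≤ ν_T(y₁)^θ ν_T(y₂)^{1−θ}`** (`T ≥ 1`, `y₁, y₂ > 0`, `0 ≤ θ ≤ 1`): the growth rate `ν_T` is a log-convex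
function of `log y` (Hölder on each `Z_n`, then `n`-th roots and the limit `Z_n^{1/n} → ν_T`).
[cite: BeatonBousquetMelouDeGierDuminilCopinGuttmann2014, Proposition 6 (arXiv v5 p. 10: "Finally, μ_T(1,y) is a log-convex and thus continuous function of log(y)"; proof p. 11: "easily adapted from [16]")] -/
theorem stripNu_interp_le (hT : 1 ≤ T) {y₁ y₂ : ℝ} (hy₁ : 0 < y₁) (hy₂ : 0 < y₂) {θ : ℝ} (hθ₀ : 0 ≤ θ) (hθ₁ : θ ≤ 1) :
    stripNu T (y₁ ^ θ * y₂ ^ (1 - θ)) ≤ stripNu T y₁ ^ θ * stripNu T y₂ ^ (1 - θ) := by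
  have hy : 0 < y₁ ^ θ * y₂ ^ (1 - θ) := mul_pos (Real.rpow_pos_of_pos hy₁ _) (Real.rpow_pos_of_pos hy₂ _)
  have h1θ : 0 ≤ 1 - θ := sub_nonneg.2 hθ₁
  have hlim := ((tendsto_stripZL_rpow hT hy₁).rpow_const (Or.inr hθ₀)).mul
    ((tendsto_stripZL_rpow hT hy₂).rpow_const (Or.inr h1θ))
  refine le_of_tendsto_of_tendsto' (tendsto_stripZL_rpow hT hy) hlim fun n => ?_
  have hZ₁ := stripZL_nonneg T n hy₁.le
  have hZ₂ := stripZL_nonneg T n hy₂.le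
  have hn : 0 ≤ 1 / (n : ℝ) := by positivity
  calc stripZL T n (y₁ ^ θ * y₂ ^ (1 - θ)) ^ (1 / (n : ℝ))
      ≤ (stripZL T n y₁ ^ θ * stripZL T n y₂ ^ (1 - θ)) ^ (1 / (n : ℝ)) :=
        Real.rpow_le_rpow (stripZL_nonneg T n hy.le) (stripZL_interp_le T n hy₁ hy₂ hθ₀ hθ₁) hn
    _ = (stripZL T n y₁ ^ (1 / (n : ℝ))) ^ θ * (stripZL T n y₂ ^ (1 / (n : ℝ))) ^ (1 - θ) := by
        rw [Real.mul_rpow (Real.rpow_nonneg hZ₁ _) (Real.rpow_nonneg hZ₂ _), ← Real.rpow_mul hZ₁, ← Real.rpow_mul hZ₂,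
          mul_comm θ, mul_comm (1 - θ), Real.rpow_mul hZ₁, Real.rpow_mul hZ₂]

/-- **`s ↦ log ν_T(e^s)` is convex on `ℝ`** — Proposition 6's "log-convex function of `log y`", as a `ConvexOn` statement.
[cite: BeatonBousquetMelouDeGierDuminilCopinGuttmann2014, Proposition 6 (arXiv v5 p. 10, last sentence)] -/
theorem convexOn_log_stripNu_exp (hT : 1 ≤ T) :
    ConvexOn ℝ Set.univ (fun s : ℝ => Real.log (stripNu T (Real.exp s))) := by
  refine ⟨convex_univ, fun s₁ _ s₂ _ a b ha hb hab => ?_⟩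
  obtain rfl : b = 1 - a := by linarith
  have hν₁ := stripNu_pos hT (Real.exp_pos s₁)
  have hν₂ := stripNu_pos hT (Real.exp_pos s₂)
  have key := stripNu_interp_le hT (Real.exp_pos s₁) (Real.exp_pos s₂) ha (by linarith)
  have hexp : Real.exp s₁ ^ a * Real.exp s₂ ^ (1 - a) = Real.exp (a • s₁ + (1 - a) • s₂) := by
    rw [← Real.exp_mul, ← Real.exp_mul, ← Real.exp_add, smul_eq_mul, smul_eq_mul, mul_comm s₁, mul_comm s₂]
  rw [hexp] at key
  have hν := stripNu_pos hT (Real.exp_pos (a • s₁ + (1 - a) • s₂))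
  calc Real.log (stripNu T (Real.exp (a • s₁ + (1 - a) • s₂)))
      ≤ Real.log (stripNu T (Real.exp s₁) ^ a * stripNu T (Real.exp s₂) ^ (1 - a)) := Real.log_le_log hν key
    _ = a • Real.log (stripNu T (Real.exp s₁)) + (1 - a) • Real.log (stripNu T (Real.exp s₂)) := by
        rw [Real.log_mul (Real.rpow_pos_of_pos hν₁ _).ne' (Real.rpow_pos_of_pos hν₂ _).ne', Real.log_rpow hν₁,
          Real.log_rpow hν₂, smul_eq_mul, smul_eq_mul]

/-- Two-sided squeeze from the tree's moduli: `ν_T(y₀) ≤ ν_T(y) ≤ (y/y₀) ν_T(y₀)` for `0 < y₀ ≤ y`.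
[cite: BeatonBousquetMelouDeGierDuminilCopinGuttmann2014, Proposition 6 (arXiv v5 p. 10: "non-decreasing in y", "continuous")] -/
theorem stripNu_le_div_mul (hT : 1 ≤ T) {y₀ y : ℝ} (hy₀ : 0 < y₀) (hle : y₀ ≤ y) :
    stripNu T y ≤ y / y₀ * stripNu T y₀ := by
  have h := stripNu_scale_le hT hy₀ ((one_le_div hy₀).2 hle)
  rwa [div_mul_cancel₀ y hy₀.ne'] at h

/-- **`ν_T` is continuous on `(0, ∞)`** (Proposition 6: "and thus continuous"; here from the two one-sided moduli
`ν_T(y₀) ≤ ν_T(y) ≤ (y/y₀) ν_T(y₀)`, `y ≥ y₀`, of `HexSAWStripSurfaceGrowth.lean`).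
[cite: BeatonBousquetMelouDeGierDuminilCopinGuttmann2014, Proposition 6 (arXiv v5 p. 10, last sentence)] -/
theorem continuousOn_stripNu (hT : 1 ≤ T) : ContinuousOn (stripNu T) (Set.Ioi 0) := by
  intro y₀ hy₀
  rw [Set.mem_Ioi] at hy₀
  have hν₀ := stripNu_pos hT hy₀
  -- squeeze between `min(1, y/y₀) ν(y₀)` and `max(1, y/y₀) ν(y₀)`
  have hlow : ∀ y, 0 < y → min 1 (y / y₀) * stripNu T y₀ ≤ stripNu T y := by
    intro y hy
    rcases le_total y₀ y with h | h
    · calc min 1 (y / y₀) * stripNu T y₀ ≤ 1 * stripNu T y₀ :=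
            mul_le_mul_of_nonneg_right (min_le_left _ _) hν₀.le
        _ ≤ stripNu T y := by rw [one_mul]; exact stripNu_mono_y hT hy₀ h
    · have h2 := stripNu_le_div_mul hT hy h
      -- `ν(y₀) ≤ (y₀/y) ν(y)` ⇒ `(y/y₀) ν(y₀) ≤ ν(y)`
      have h3 : y / y₀ * stripNu T y₀ ≤ stripNu T y := by
        have := mul_le_mul_of_nonneg_left h2 (div_pos hy hy₀).le
        have e : y / y₀ * (y₀ / y) = 1 := by field_simp
        rwa [← mul_assoc, e, one_mul] at this
      exact (mul_le_mul_of_nonneg_right (min_le_right _ _) hν₀.le).trans h3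
  have hup : ∀ y, 0 < y → stripNu T y ≤ max 1 (y / y₀) * stripNu T y₀ := by
    intro y hy
    rcases le_total y₀ y with h | h
    · exact (stripNu_le_div_mul hT hy₀ h).trans (mul_le_mul_of_nonneg_right (le_max_right _ _) hν₀.le)
    · calc stripNu T y ≤ stripNu T y₀ := stripNu_mono_y hT hy h
        _ = 1 * stripNu T y₀ := (one_mul _).symm
        _ ≤ max 1 (y / y₀) * stripNu T y₀ := mul_le_mul_of_nonneg_right (le_max_left _ _) hν₀.le
  have hcont : ContinuousAt (fun y : ℝ => y / y₀) y₀ := (continuous_id.div_const y₀).continuousAt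
  have h1 : Tendsto (fun y : ℝ => min 1 (y / y₀) * stripNu T y₀) (𝓝[Set.Ioi 0] y₀) (𝓝 (stripNu T y₀)) := by
    have := ((continuous_const.min (continuous_id.div_const y₀)).mul continuous_const).continuousAt.tendsto
      (x := y₀) (f := fun y : ℝ => min 1 (y / y₀) * stripNu T y₀)
    rw [div_self hy₀.ne', min_self, one_mul] at this
    exact this.mono_left nhdsWithin_le_nhds
  have h2 : Tendsto (fun y : ℝ => max 1 (y / y₀) * stripNu T y₀) (𝓝[Set.Ioi 0] y₀) (𝓝 (stripNu T y₀)) := by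
    have := ((continuous_const.max (continuous_id.div_const y₀)).mul continuous_const).continuousAt.tendsto
      (x := y₀) (f := fun y : ℝ => max 1 (y / y₀) * stripNu T y₀)
    rw [div_self hy₀.ne', max_self, one_mul] at this
    exact this.mono_left nhdsWithin_le_nhds
  refine tendsto_of_tendsto_of_tendsto_of_le_of_le' h1 h2 ?_ ?_
  · exact eventually_nhdsWithin_of_forall fun y hy => hlow y hy
  · exact eventually_nhdsWithin_of_forall fun y hy => hup y hy

/-! ### Strictness propagated by log-convexity (the mechanism of Corollary 8's uniqueness clause) -/

/-- Every point strictly between `y₁ < y₂` (positive) is a geometric interpolation `y₁^θ y₂^{1−θ}`, `θ ∈ (0,1)`. [folklore] -/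
private theorem exists_rpow_interp_eq {y₁ y y₂ : ℝ} (hy₁ : 0 < y₁) (h₁ : y₁ < y) (h₂ : y < y₂) :
    ∃ θ : ℝ, 0 < θ ∧ θ < 1 ∧ y₁ ^ θ * y₂ ^ (1 - θ) = y := by
  have hy : 0 < y := hy₁.trans h₁
  have hy₂ : 0 < y₂ := hy.trans h₂
  have hnum : 0 < Real.log y₂ - Real.log y := sub_pos.2 (Real.log_lt_log hy h₂)
  have hden : Real.log y₂ - Real.log y < Real.log y₂ - Real.log y₁ := by linarith [Real.log_lt_log hy₁ h₁]
  have hden0 : 0 < Real.log y₂ - Real.log y₁ := hnum.trans hden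
  refine ⟨(Real.log y₂ - Real.log y) / (Real.log y₂ - Real.log y₁), div_pos hnum hden0, (div_lt_one hden0).2 hden, ?_⟩
  rw [Real.rpow_def_of_pos hy₁, Real.rpow_def_of_pos hy₂, ← Real.exp_add]
  nth_rw 3 [← Real.exp_log hy]
  congr 1
  field_simp
  ring

/-- **Strictness below**: if `ν_T(y₁) < ν_T(y₂)` for some `0 < y₁ < y₂`, then `ν_T(y) < ν_T(y₂)` for EVERY `0 < y < y₂`
(a convex non-decreasing function of `log y` that is not constant on `[y₁, y₂]` is nowhere on `(0, y₂)` equal to its value at `y₂`).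
[cite: BeatonBousquetMelouDeGierDuminilCopinGuttmann2014, Corollary 8, proof (arXiv v5 p. 13: "The uniqueness of y_T follows from the log-convexity of ρ_T(y) in log y, together with ρ_T(1) > x_c: this precludes having ρ_T(y) = ρ_T(y′) = x_c with y ≠ y′")] -/
theorem stripNu_lt_of_lt_right (hT : 1 ≤ T) {y₁ y₂ : ℝ} (hy₁ : 0 < y₁) (h₁₂ : y₁ < y₂)
    (hν : stripNu T y₁ < stripNu T y₂) {y : ℝ} (hy : 0 < y) (hy₂ : y < y₂) : stripNu T y < stripNu T y₂ := by
  rcases le_or_gt y y₁ with h | h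
  · exact (stripNu_mono_y hT hy h).trans_lt hν
  obtain ⟨θ, hθ₀, hθ₁, hθ⟩ := exists_rpow_interp_eq hy₁ h hy₂
  have hν₁ := stripNu_pos hT hy₁
  have hν₂ := stripNu_pos hT (hy₁.trans h₁₂)
  calc stripNu T y = stripNu T (y₁ ^ θ * y₂ ^ (1 - θ)) := by rw [hθ]
    _ ≤ stripNu T y₁ ^ θ * stripNu T y₂ ^ (1 - θ) := stripNu_interp_le hT hy₁ (hy₁.trans h₁₂) hθ₀.le hθ₁.le
    _ < stripNu T y₂ ^ θ * stripNu T y₂ ^ (1 - θ) :=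
        mul_lt_mul_of_pos_right (Real.rpow_lt_rpow hν₁.le hν hθ₀) (Real.rpow_pos_of_pos hν₂ _)
    _ = stripNu T y₂ := by rw [← Real.rpow_add hν₂, add_sub_cancel, Real.rpow_one]

/-- **Strictness above**: if `ν_T(y₁) < ν_T(y₂)` for some `0 < y₁ < y₂`, then `ν_T(y₂) < ν_T(y)` for EVERY `y > y₂`
(a convex non-decreasing function of `log y` is strictly increasing to the right of any strict pair).
[cite: BeatonBousquetMelouDeGierDuminilCopinGuttmann2014, Corollary 8, proof (arXiv v5 p. 13: log-convexity "together with ρ_T(1) > x_c … precludes having ρ_T(y) = ρ_T(y′) = x_c with y ≠ y′")] -/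
theorem stripNu_lt_of_right_lt (hT : 1 ≤ T) {y₁ y₂ : ℝ} (hy₁ : 0 < y₁) (h₁₂ : y₁ < y₂)
    (hν : stripNu T y₁ < stripNu T y₂) {y : ℝ} (hy₂ : y₂ < y) : stripNu T y₂ < stripNu T y := by
  have hy₂pos : 0 < y₂ := hy₁.trans h₁₂
  have hy : 0 < y := hy₂pos.trans hy₂
  obtain ⟨θ, hθ₀, hθ₁, hθ⟩ := exists_rpow_interp_eq hy₁ h₁₂ hy₂
  have hν₁ := stripNu_pos hT hy₁
  have hν₂ := stripNu_pos hT hy₂pos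
  have hνy := stripNu_pos hT hy
  by_contra hle
  replace hle : stripNu T y ≤ stripNu T y₂ := not_lt.1 hle
  have h1 : stripNu T y₂ ≤ stripNu T y₁ ^ θ * stripNu T y ^ (1 - θ) := by
    have := stripNu_interp_le hT hy₁ hy hθ₀.le hθ₁.le
    rwa [hθ] at this
  have h2 : stripNu T y₁ ^ θ * stripNu T y ^ (1 - θ) < stripNu T y₂ := by
    calc stripNu T y₁ ^ θ * stripNu T y ^ (1 - θ) ≤ stripNu T y₁ ^ θ * stripNu T y₂ ^ (1 - θ) :=
          mul_le_mul_of_nonneg_left (Real.rpow_le_rpow hνy.le hle (sub_pos.2 hθ₁).le) (Real.rpow_nonneg hν₁.le _)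
      _ < stripNu T y₂ ^ θ * stripNu T y₂ ^ (1 - θ) :=
          mul_lt_mul_of_pos_right (Real.rpow_lt_rpow hν₁.le hν hθ₀) (Real.rpow_pos_of_pos hν₂ _)
      _ = stripNu T y₂ := by rw [← Real.rpow_add hν₂, add_sub_cancel, Real.rpow_one]
  exact absurd (h1.trans_lt h2) (lt_irrefl _)

/-- **`ν_T` is strictly increasing on `[y₂, ∞)`** as soon as `ν_T(y₁) < ν_T(y₂)` for some `0 < y₁ < y₂`.
[cite: BeatonBousquetMelouDeGierDuminilCopinGuttmann2014, Corollary 8, proof (arXiv v5 p. 13: "the log-convexity of ρ_T(y) in log y")] -/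
theorem strictMonoOn_stripNu_Ici (hT : 1 ≤ T) {y₁ y₂ : ℝ} (hy₁ : 0 < y₁) (h₁₂ : y₁ < y₂)
    (hν : stripNu T y₁ < stripNu T y₂) : StrictMonoOn (stripNu T) (Set.Ici y₂) := by
  intro a ha b hb hab
  rw [Set.mem_Ici] at ha hb
  have hy₂pos : 0 < y₂ := hy₁.trans h₁₂
  rcases ha.eq_or_lt with rfl | ha'
  · exact stripNu_lt_of_right_lt hT hy₁ h₁₂ hν hab
  -- strict pair `(y₂, b)`, then strictness below `b`
  have hb' : y₂ < b := ha'.trans hab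
  have hνb : stripNu T y₂ < stripNu T b := stripNu_lt_of_right_lt hT hy₁ h₁₂ hν hb'
  exact stripNu_lt_of_lt_right hT hy₂pos hb' hνb (hy₂pos.trans ha') hab

end Literature.Probability.RandomPlanarGeometry.SAW.HV
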